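import Mathlib.Algebra.Group.ForwardDiff
import HarnessLib

/-!
# Route ValuedFieldSpecialisation — crux `CTConstruction`: the alternating sum `Σ (-1)^(n-i) C(n,i) i^k`

Helper toward crux stmt-KontsevichZagierPeriods-3495 (`CTConstruction`), line `registered`, stub
`stub_altSum_choose_mul_pow` of the lead's "dilation elimination". Pure combinatorics over `ℤ`,
used by the lead to evaluate `(Θ − 1)^n` on the pure-logarithm block: for `k ≤ n`,

  `Σ_{i=0}^{n} (−1)^{n−i} C(n,i) i^k = n!` if `k = n`, and `= 0` if `k < n`.

The left-hand side is the `n`-th forward difference of `x ↦ x^k` at `0`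
(Mathlib's `fwdDiff_iter_eq_sum_shift`), which is the constant `n!` for `k = n`
(`fwdDiff_iter_eq_factorial`) and vanishes for `k < n` (`fwdDiff_iter_pow_eq_zero_of_lt`);
equivalently `Σ_i (−1)^{n−i} C(n,i) i^k = n! · S(k,n)` with `S` the Stirling numbers of the
second kind.

Sources: folklore (calculus of finite differences); Mathlib `Mathlib.Algebra.Group.ForwardDiff`.
No new definitions.
-/

namespace Summit.KontsevichZagierPeriods.ValuedFieldSpecialisation

open Finset

/-- The `n`-th forward difference (step `1`) of `x ↦ x ^ k` on `ℤ` at `0`, written out as the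
alternating binomial sum `Σ_{i=0}^{n} (−1)^(n−i) C(n,i) i^k` (Mathlib's
`fwdDiff_iter_eq_sum_shift`, with the scalar action of `ℤ` on itself unfolded to multiplication).
[folklore] -/
theorem fwdDiff_iter_pow_apply_zero_eq_altSum (n k : ℕ) :
    (fwdDiff (1 : ℤ))^[n] (fun r : ℤ => r ^ k) 0 =
      ∑ i ∈ Finset.range (n + 1), (-1 : ℤ) ^ (n - i) * (n.choose i : ℤ) * (i : ℤ) ^ k := by
  rw [fwdDiff_iter_eq_sum_shift]
  refine Finset.sum_congr rfl fun i _ => ?_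
  simp only [zero_add, nsmul_eq_mul, mul_one, smul_eq_mul, mul_assoc]

/-- **Alternating binomial sum against powers.** For natural numbers `k ≤ n`,
`Σ_{i=0}^{n} (−1)^(n−i) C(n,i) i^k` equals `n!` if `k = n` and `0` if `k < n`: it is the `n`-th
forward difference of `x ↦ x^k` at `0`, which is the constant `n!` when `k = n`
(`fwdDiff_iter_eq_factorial`) and identically zero when `k < n`
(`fwdDiff_iter_pow_eq_zero_of_lt`). The exponent `n - i` is natural-number subtraction, harmless
since `i ≤ n` on `Finset.range (n + 1)`. [folklore] -/
theorem stub_altSum_choose_mul_pow : ∀ (n k : ℕ), k ≤ n → (∑ i ∈ Finset.range (n + 1), (-1 : ℤ) ^ (n - i) * (n.choose i : ℤ) * (i : ℤ) ^ k) = if k = n then (n.factorial : ℤ) else 0 := by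
  intro n k hk
  rw [← fwdDiff_iter_pow_apply_zero_eq_altSum]
  split_ifs with h
  · subst h
    rw [fwdDiff_iter_eq_factorial]
    rfl
  · rw [fwdDiff_iter_pow_eq_zero_of_lt (lt_of_le_of_ne hk h)]
    rfl

end Summit.KontsevichZagierPeriods.ValuedFieldSpecialisation
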